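import Mathlib

/-!
# The fast-energy identity of the swirling-cone system (K30)

Solo seat `solo-NavierStokesRegularity-informed`, session 13; companion of
`paper/axisymmetric-rigidity.md` §5f, Lemma 8.22. Along a solution `(u, v, s, p)(φ)` of the reduced system (S)
(`v u' = v² + s² - 2p - u - u²`, `v' = -3u - v cot φ`, `v s' = -s(1 + 2u + v cot φ)`, `p' = (u-1)v + (v² + s²)cot φ`,
`cot' = -(1 + cot²)`), put `c = cot φ`, `U = 1 + 2u + 2vc` (distance to the slow manifold), `w = s² - 2p + 1/4`,
`W = w + (3/2)vc` and the FAST ENERGY `E = s²U² + W²`. Then, exactly,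
  `U' = (2/v)W - Uc - U²/(2v)`, `W' = -(2s²/v)U + (3 - U)v + (3/2)(vc)'`, and
  `E' = -3s²U³/v + 2W·g`,  `g = (3/2)v + (9/4)c + (3/2)vc² - U(v + (9/4)c) = (3/(2sin²φ))(v + (3/2)sin φ cos φ) - U(v + (9/4)c)`:
the `O(s²)` cross terms cancel, so the fast energy is driven only by `O(1)` quantities — the a-priori bound
`|U| ≤ √E/s = O(1/σ)` of Corollary 8.23 follows by Gronwall. The derivatives enter as real variables constrained by
the equations (pure algebra; the calculus is the chain rule). No new definitions; axioms: standard.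
-/

namespace Summit.NavierStokesRegularity.NavierStokesRegularity.Theorems

/-- `U' = 2u' + 2v'c + 2vc' = (2/v)W - Uc - U²/(2v)` along (S). -/
theorem fastEnergy_dU {u v s p c du dv dc : ℝ} (hv : v ≠ 0)
    (h1 : v * du = v ^ 2 + s ^ 2 - 2 * p - u - u ^ 2) (h2 : dv = -3 * u - v * c) (h5 : dc = -(1 + c ^ 2)) :
    2 * du + 2 * dv * c + 2 * v * dc
      = 2 / v * (s ^ 2 - 2 * p + 1 / 4 + 3 / 2 * v * c) - (1 + 2 * u + 2 * v * c) * c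
        - (1 + 2 * u + 2 * v * c) ^ 2 / (2 * v) := by
  have hdu : du = (v ^ 2 + s ^ 2 - 2 * p - u - u ^ 2) / v := by
    field_simp; linarith [h1]
  rw [hdu, h2, h5]
  field_simp
  ring

/-- `W' = 2ss' - 2p' + (3/2)(v'c + vc') = -(2s²/v)U + (3 - U)v + (3/2)(v'c + vc')` along (S). -/
theorem fastEnergy_dW {u v s c ds dp dv dc : ℝ} (hv : v ≠ 0)
    (h3 : v * ds = -s * (1 + 2 * u + v * c)) (h4 : dp = (u - 1) * v + (v ^ 2 + s ^ 2) * c) :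
    2 * s * ds - 2 * dp + 3 / 2 * (dv * c + v * dc)
      = -(2 * s ^ 2 / v) * (1 + 2 * u + 2 * v * c) + (3 - (1 + 2 * u + 2 * v * c)) * v
        + 3 / 2 * (dv * c + v * dc) := by
  have hds : ds = -s * (1 + 2 * u + v * c) / v := by
    field_simp; linarith [h3]
  rw [hds, h4]
  field_simp
  ring

/-- LEMMA 8.22 (fast-energy identity). With `E = s²U² + W²`:
`E' = 2ss'U² + 2s²UU' + 2WW' = -3s²U³/v + 2W·g`, `g = (3/2)v + (9/4)c + (3/2)vc² - U(v + (9/4)c)`. -/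
theorem fastEnergy_identity {u v s p c du dv ds dp dc : ℝ} (hv : v ≠ 0)
    (h1 : v * du = v ^ 2 + s ^ 2 - 2 * p - u - u ^ 2) (h2 : dv = -3 * u - v * c)
    (h3 : v * ds = -s * (1 + 2 * u + v * c)) (h4 : dp = (u - 1) * v + (v ^ 2 + s ^ 2) * c)
    (h5 : dc = -(1 + c ^ 2)) :
    let U := 1 + 2 * u + 2 * v * c
    let W := s ^ 2 - 2 * p + 1 / 4 + 3 / 2 * v * c
    let dU := 2 * du + 2 * dv * c + 2 * v * dc
    let dW := 2 * s * ds - 2 * dp + 3 / 2 * (dv * c + v * dc)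
    let g := 3 / 2 * v + 9 / 4 * c + 3 / 2 * v * c ^ 2 - U * (v + 9 / 4 * c)
    2 * s * ds * U ^ 2 + 2 * s ^ 2 * U * dU + 2 * W * dW = -3 * s ^ 2 * U ^ 3 / v + 2 * W * g := by
  intro U W dU dW g
  have hdu : du = (v ^ 2 + s ^ 2 - 2 * p - u - u ^ 2) / v := by
    field_simp; linarith [h1]
  have hds : ds = -s * (1 + 2 * u + v * c) / v := by
    field_simp; linarith [h3]
  simp only [U, W, dU, dW, g]
  rw [hdu, hds, h2, h4, h5]
  field_simp
  ring

/-- The forcing `g` measured from the linear cone: `(3/2)v + (9/4)cot φ + (3/2)v cot²φ = (3/(2sin²φ))(v + (3/2)sin φ cos φ)`,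
and `-(3/2)sin φ cos φ` is the `v` of the linear cone (`z₁ = π/2`). -/
theorem fastEnergy_g_linear_cone {φ : ℝ} (hs : Real.sin φ ≠ 0) (v : ℝ) :
    3 / 2 * v + 9 / 4 * (Real.cos φ / Real.sin φ) + 3 / 2 * v * (Real.cos φ / Real.sin φ) ^ 2
      = 3 / (2 * Real.sin φ ^ 2) * (v + 3 / 2 * Real.sin φ * Real.cos φ) := by
  have key := Real.sin_sq_add_cos_sq φ
  field_simp
  linear_combination (24 * v) * key

/-- The pointwise consequence used in Corollary 8.23: `s²U² ≤ E`, i.e. `|U| ≤ √E/|s|`. -/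
theorem fastEnergy_U_le {s U W E : ℝ} (hE : E = s ^ 2 * U ^ 2 + W ^ 2) (hs : s ≠ 0) :
    |U| ≤ Real.sqrt E / |s| := by
  rw [le_div_iff₀ (abs_pos.mpr hs), hE]
  have h : |U| * |s| = Real.sqrt ((s * U) ^ 2) := by
    rw [Real.sqrt_sq_eq_abs, abs_mul, mul_comm]
  rw [h]
  exact Real.sqrt_le_sqrt (by nlinarith [sq_nonneg W])

/-- The differential inequality behind Corollary 8.23: `E' ≤ 3(|U|/|v|)E + 2|W||g|`. -/
theorem fastEnergy_dE_le {s U W E v g : ℝ} (hE : E = s ^ 2 * U ^ 2 + W ^ 2) (hv : v ≠ 0) :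
    -3 * s ^ 2 * U ^ 3 / v + 2 * W * g ≤ 3 * (|U| / |v|) * E + 2 * |W| * |g| := by
  have h1 : -3 * s ^ 2 * U ^ 3 / v ≤ 3 * (|U| / |v|) * E := by
    have ha : |-3 * s ^ 2 * U ^ 3 / v| = 3 * (|U| / |v|) * (s ^ 2 * U ^ 2) := by
      rw [abs_div, abs_mul, abs_mul, abs_pow, abs_pow]
      have : |(-3 : ℝ)| = 3 := by norm_num
      rw [this, pow_succ |U| 2, sq_abs, sq_abs]
      ring
    have hb : 3 * (|U| / |v|) * (s ^ 2 * U ^ 2) ≤ 3 * (|U| / |v|) * E := by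
      apply mul_le_mul_of_nonneg_left _ (by positivity)
      rw [hE]; nlinarith [sq_nonneg W]
    exact (le_abs_self _).trans (ha ▸ hb)
  have h2 : 2 * W * g ≤ 2 * |W| * |g| := by
    rw [mul_assoc, mul_assoc, ← abs_mul]
    exact mul_le_mul_of_nonneg_left (le_abs_self _) (by norm_num)
  linarith

end Summit.NavierStokesRegularity.NavierStokesRegularity.Theorems
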